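import Literature.Barriers.AtomisticToContinuum.HardDiskTranslationInvarianceStepsProofs
import Literature.Barriers.AtomisticToContinuum.HardDiskGibbsKernel
import Literature.Barriers.AtomisticToContinuum.HardDiskBoxGeometry
import Mathlib.Combinatorics.SimpleGraph.Paths
import Mathlib.Combinatorics.SimpleGraph.Connectivity.Connected
import Mathlib.Analysis.SpecificLimits.Normed
import HarnessLib

/-!
# Cluster bounds for the hard-disc model: Richthammer 2007, Lemma 7 (proved)

Companion of `HardDiskTranslationInvarianceSteps.lean` (provefact
`Literature.Barriers.AtomisticToContinuum.HardDisk.Richthammer2007_hardDisk`): the first lemma of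
the proof of Theorem 1 (§5.2), controlling the range of the `ε`-clusters of the central box.

Setting [Richthammer2007, §3.1, §5.1–5.2]: for a configuration `X`, the bond set
`K_n^{X,ε} := {x₁x₂ ∈ E(X) : x₁x₂ ∩ Λ_n ≠ ∅, x₁ - x₂ ∈ K_ε}`, where `K_ε` is the `ε`-enlargement of
the hard core `K = {|x|₂ ≤ 1}` — for the Euclidean disc the open ball of radius `1 + ε` — defines
the graph `(X, K_n^{X,ε})`; `C_{X,B}(Λ)` is the union of the `B`-clusters of the points of `X ∩ Λ`,
and `r_{n,X}(Λ) := sup{|y'| : y' ∈ C_{X,K_n^{X,ε}}(Λ)}` (maximum norm `|.|`) is its range.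

* `epsBond`, `epsConnected`, `cluster`, `clusterRange` — these objects (`supNorm` = `|.|` from
  `HardDiskBoxGeometry.lean`); `annulus ε = K_ε ∖ K`;
* the path-expansion engine shared with the §6.8 estimates: `exists_path_of_epsConnected`
  (connected points are joined by a self-avoiding bond path, as an injective tuple of points of `X`),
  `abs_supNorm_sub_le_of_path` (`| |x_k| - |x₀| | ≤ k c_K`, `c_K = 1 + ε`), the path weights
  `pathFun w ε m x = w(x₀) ∏ 1_{K_ε∖K}(x_{i+1} - x_i)` with `pathFun_eq_of_path` (on a hard-disc
  configuration a bond path has all its bonds in the annulus, by (3.2)) and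
  `lintegral_pathFun` (`∫ pathFun = (∫ w) c_ε^m`, integrating out `x_m, x_{m-1}, …` by translation
  invariance, `lintegral_chainFun`);
* `Richthammer2007_lemma7` (**proved**): if `ε > 0` satisfies `c_ε z < 1`,
  `c_ε := λ²(K_ε ∖ K)` (the standing choice (5.1) of §5.1, with the Ruelle bound `ξ = 1`), then for
  every Gibbs measure `μ` and `n' ∈ ℕ`, `sup_{n > n'} ∫ μ(dX) r_{n,X}(Λ_{n'}) < ∞`
  [Richthammer2007, §5.2 Lemma 7, proof §6.1]: every point of the cluster is reached from
  `X ∩ Λ_{n'}` by a self-avoiding path `x₀, …, x_m` of bonds, so `|x_m| ≤ n' + m c_K` and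
  `r ≤ n' + ∑_{m} ∑≠_{x₀,…,x_m ∈ X} m c_K 1{x₀ ∈ Λ_{n'}} ∏ 1{x_i x_{i-1} bond}`
  (`supNorm_le_of_mem_cluster`, `clusterRange_le_pathSum`); almost surely the hard core turns
  each bond indicator into `1_{K_ε ∖ K}(x_i - x_{i-1})` (`IsGibbs.ae_isHardCore`); Lemma 3
  (`Richthammer2007_lemma3_holds`) bounds the expectation of the `m`-th term by
  `z^{m+1} (2n')² m c_K c_ε^m`, and `∑_m m (c_ε z)^m < ∞`.

## References

* [Richthammer2007] T. Richthammer, *Translation-invariance of two-dimensional Gibbsian point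
  processes*, Comm. Math. Phys. 274 (2007) 81–122, arXiv:0706.3637: §3.1 (p. 5, clusters),
  §5.1 (5.1)–(5.2) (p. 10), §5.2 Lemma 7 (p. 11), §6.1 (p. 13).
-/

noncomputable section

open MeasureTheory Set
open scoped ENNReal

namespace Literature.Barriers.AtomisticToContinuum.HardDisk

open Literature.Analysis.FunctionSpaces

/-- The plane. -/
local notation "E2" => EuclideanSpace ℝ (Fin 2)

/-! ### Bonds, clusters and their range -/

/-- **The bonds `K_n^{X,ε}`** (as a relation on the plane; membership in `X` is imposed by
`epsConnected`): two distinct points, at least one of them in `Λ_n`, whose difference lies in the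
`ε`-enlargement `K_ε` of the hard core — for the Euclidean unit disc, at distance `< 1 + ε`.
[cite: Richthammer2007, §5.2 (p. 11)] -/
def epsBond (ε : ℝ) (n : ℕ) (x x' : E2) : Prop :=
  x ≠ x' ∧ (x ∈ box n ∨ x' ∈ box n) ∧ dist x x' < 1 + ε

/-- The bond relation is symmetric. [folklore] -/
theorem epsBond_symm {ε : ℝ} {n : ℕ} {x x' : E2} (h : epsBond ε n x x') : epsBond ε n x' x :=
  ⟨h.1.symm, h.2.1.symm, by rw [dist_comm]; exact h.2.2⟩

/-- **Connectedness in the graph `(X, K_n^{X,ε})`**: `x ⟷ x'` iff there are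
`x = x₀, x₁, …, x_m = x'` in `X` with consecutive bonds (Richthammer 2007, §3.1).
[cite: Richthammer2007, §3.1 (p. 5)] -/
def epsConnected (ε : ℝ) (n : ℕ) (X : PointConfig E2) (x x' : E2) : Prop :=
  Relation.ReflTransGen (fun a b => a ∈ X ∧ b ∈ X ∧ epsBond ε n a b) x x'

/-- **The cluster `C_{X,K_n^{X,ε}}(Λ)`** of a set `Λ`: the union of the clusters of the points of
`X ∩ Λ` (Richthammer 2007, §3.1). [cite: Richthammer2007, §3.1 (p. 5)] -/
def cluster (ε : ℝ) (n : ℕ) (X : PointConfig E2) (Λ : Set E2) : Set E2 :=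
  {y | ∃ x' ∈ X, x' ∈ Λ ∧ epsConnected ε n X x' y}

/-- **The range `r_{n,X}(Λ) := sup{|y'| : y' ∈ C_{X,K_n^{X,ε}}(Λ)}`** of the cluster of `Λ`
(an extended real; `0` for an empty cluster). [cite: Richthammer2007, §5.2 (p. 11)] -/
def clusterRange (ε : ℝ) (n : ℕ) (X : PointConfig E2) (Λ : Set E2) : ℝ≥0∞ :=
  ⨆ y ∈ cluster ε n X Λ, ENNReal.ofReal (supNorm y)

/-! ### The path expansion -/

/-- The annulus `K_ε ∖ K = {1 < |v|₂ < 1 + ε}` for the Euclidean unit disc. [cite: Richthammer2007, §5.1 (5.1) (p. 10)] -/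
def annulus (ε : ℝ) : Set E2 := {v | 1 < ‖v‖ ∧ ‖v‖ < 1 + ε}

/-- The annulus is `K_ε ∖ K` written with balls. [folklore] -/
theorem annulus_eq (ε : ℝ) : annulus ε = Metric.ball (0 : E2) (1 + ε) \ Metric.closedBall 0 1 := by
  ext v
  simp only [annulus, Set.mem_setOf_eq, Set.mem_sdiff, Metric.mem_ball, Metric.mem_closedBall,
    dist_zero_right, not_le]
  tauto

/-- The annulus is measurable. [folklore] -/
theorem measurableSet_annulus (ε : ℝ) : MeasurableSet (annulus ε) := by
  rw [annulus_eq]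
  exact measurableSet_ball.diff measurableSet_closedBall

/-- The weight of a path `x₀, …, x_m` with head weight `w`: `w(x₀) ∏_i 1_{K_ε ∖ K}(x_{i+1} - x_i)`
(Richthammer 2007, §6.1 and §6.8: the summands of the path expansions after (3.2), with
`w = 1_{Λ_{n'}}` resp. `w = 1_{Λ_n̄} q(|·| - R̄)²/Q²`). [cite: Richthammer2007, §6.1 (p. 13)] -/
def pathFun (w : E2 → ℝ≥0∞) (ε : ℝ) (m : ℕ) (x : Fin (m + 1) → E2) : ℝ≥0∞ :=
  w (x 0) * ∏ i : Fin m, (annulus ε).indicator 1 (x i.succ - x i.castSucc)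

/-- The path weight is measurable. [folklore] -/
theorem measurable_pathFun {w : E2 → ℝ≥0∞} (hw : Measurable w) (ε : ℝ) (m : ℕ) :
    Measurable (pathFun w ε m) := by
  unfold pathFun
  refine Measurable.mul (hw.comp (measurable_pi_apply 0)) ?_
  refine Finset.measurable_prod _ fun i _ => ?_
  exact (measurable_one.indicator (measurableSet_annulus ε)).comp
    ((measurable_pi_apply _).sub (measurable_pi_apply _))

/-- **Self-avoiding bond paths.** If `x ⟷ x'` in `(X, K_n^{X,ε})` and `x ∈ X`, there is an
injective tuple `x = x₀, x₁, …, x_m = x'` of points of `X` with consecutive bonds (a shortest walk;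
Richthammer 2007, §6.1: "by considering all possibilities for such paths").
[cite: Richthammer2007, §6.1 (p. 13)] -/
theorem exists_path_of_epsConnected {ε : ℝ} {n : ℕ} {X : PointConfig E2} {x x' : E2} (hx : x ∈ X)
    (h : epsConnected ε n X x x') :
    ∃ (m : ℕ) (p : Fin (m + 1) → E2), Function.Injective p ∧ (∀ i, p i ∈ X) ∧ p 0 = x ∧
      p (Fin.last m) = x' ∧ ∀ i : Fin m, epsBond ε n (p i.castSucc) (p i.succ) := by
  classical
  -- the graph `(X, K_n^{X,ε})`
  let G : SimpleGraph E2 :=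
    { Adj := fun a b => a ∈ X ∧ b ∈ X ∧ epsBond ε n a b
      symm := ⟨fun a b h => ⟨h.2.1, h.1, epsBond_symm h.2.2⟩⟩
      loopless := ⟨fun a h => h.2.2.1 rfl⟩ }
  have hreach : G.Reachable x x' := (SimpleGraph.reachable_iff_reflTransGen x x').2 h
  obtain ⟨p⟩ := hreach
  set q : G.Walk x x' := p.bypass with hq
  have hqpath : q.IsPath := p.bypass_isPath
  set m : ℕ := q.length with hm
  set y : Fin (m + 1) → E2 := fun i => q.getVert i with hydef
  have hy0 : y 0 = x := by simp [hydef, SimpleGraph.Walk.getVert_zero]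
  have hym : y (Fin.last m) = x' := by simp [hydef, hm, SimpleGraph.Walk.getVert_length]
  have hadj : ∀ i : Fin m, G.Adj (y i.castSucc) (y i.succ) := fun i => by
    simp only [hydef, Fin.val_castSucc, Fin.val_succ]
    exact q.adj_getVert_succ i.2
  have hinj : Function.Injective y := by
    intro i j hij
    have h := hqpath.getVert_injOn (by simp only [Set.mem_setOf_eq]; exact Nat.lt_succ_iff.1 i.2)
      (by simp only [Set.mem_setOf_eq]; exact Nat.lt_succ_iff.1 j.2) hij
    exact Fin.ext h
  have hmem : ∀ i, y i ∈ X := by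
    intro i
    rcases Fin.eq_zero_or_eq_succ i with rfl | ⟨j, rfl⟩
    · rw [hy0]; exact hx
    · exact (hadj j).2.1
  exact ⟨m, y, hinj, hmem, hy0, hym, fun i => (hadj i).2.2⟩

/-- **Norms along a bond path**: `| |x_k| - |x₀| | ≤ k c_K` with `c_K = 1 + ε`
(`|x_i - x_{i-1}| ≤ |x_i - x_{i-1}|₂ < 1 + ε`). [cite: Richthammer2007, §6.1 (p. 13)] -/
theorem abs_supNorm_sub_le_of_path {ε : ℝ} {n m : ℕ} {p : Fin (m + 1) → E2}
    (hp : ∀ i : Fin m, epsBond ε n (p i.castSucc) (p i.succ)) (k : ℕ) (hk : k ≤ m) :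
    |supNorm (p ⟨k, Nat.lt_succ_of_le hk⟩) - supNorm (p 0)| ≤ k * (1 + ε) := by
  have hstep : ∀ i : Fin m, supNorm (p i.succ - p i.castSucc) ≤ 1 + ε ∧
      supNorm (p i.castSucc - p i.succ) ≤ 1 + ε := fun i => by
    have hd := (hp i).2.2
    constructor
    · rw [dist_comm, dist_eq_norm] at hd
      exact (supNorm_le_norm _).trans hd.le
    · rw [dist_eq_norm] at hd
      exact (supNorm_le_norm _).trans hd.le
  induction k with
  | zero =>
    have : (⟨0, Nat.lt_succ_of_le hk⟩ : Fin (m + 1)) = 0 := rfl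
    rw [this, sub_self, abs_zero, Nat.cast_zero, zero_mul]
  | succ k ih =>
    have hk' : k < m := hk
    have h1 := ih hk'.le
    have h2 := hstep ⟨k, hk'⟩
    have e1 : (⟨k, hk'⟩ : Fin m).succ = ⟨k + 1, Nat.lt_succ_of_le hk⟩ := rfl
    have e2 : (⟨k, hk'⟩ : Fin m).castSucc = ⟨k, Nat.lt_succ_of_le hk'.le⟩ := rfl
    rw [e1, e2] at h2
    have h3 := supNorm_sub_le (p ⟨k + 1, Nat.lt_succ_of_le hk⟩) (p ⟨k, Nat.lt_succ_of_le hk'.le⟩)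
    have h4 := supNorm_sub_le (p ⟨k, Nat.lt_succ_of_le hk'.le⟩) (p ⟨k + 1, Nat.lt_succ_of_le hk⟩)
    rw [abs_le] at h1 ⊢
    push_cast
    constructor <;> linarith [h1.1, h1.2, h2.1, h2.2]

/-- **On a hard-disc configuration the weight of a bond path is its head weight**: the bonds of a
self-avoiding path of `(X, K_n^{X,ε})` lie in the annulus `K_ε ∖ K` (the hard core (3.2) gives
`|x_i - x_{i-1}|₂ > 1`). [cite: Richthammer2007, §6.1 (p. 13)] -/
theorem pathFun_eq_of_path {ε : ℝ} {n m : ℕ} {X : PointConfig E2} (hX : IsHardCore X)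
    (w : E2 → ℝ≥0∞) {p : Fin (m + 1) → E2} (hinj : Function.Injective p) (hmem : ∀ i, p i ∈ X)
    (hp : ∀ i : Fin m, epsBond ε n (p i.castSucc) (p i.succ)) : pathFun w ε m p = w (p 0) := by
  unfold pathFun
  rw [Finset.prod_eq_one, mul_one]
  intro i _
  rw [Set.indicator_of_mem, Pi.one_apply]
  refine ⟨?_, ?_⟩
  · have hne : p i.succ ≠ p i.castSucc := fun h => by
      have := hinj h
      exact absurd (congrArg Fin.val this) (by simp)
    have := hX (p i.succ) (hmem _) (p i.castSucc) (hmem _) hne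
    rwa [dist_eq_norm] at this
  · have hd := (hp i).2.2
    rwa [dist_comm, dist_eq_norm] at hd

/-- **The path bound** (Richthammer 2007, §6.1): in a hard-disc configuration, every point `y` of
the cluster of `Λ_{n'}` is the endpoint of a self-avoiding bond path `x₀, …, x_m` from `X ∩ Λ_{n'}`,
whence `|y| ≤ |x₀| + ∑ |x_i - x_{i-1}| ≤ n' + m c_K`, and `m c_K` times the weight
`1{x₀ ∈ Λ_{n'}}` of that path dominates `|y| - n'`. [cite: Richthammer2007, §6.1 (p. 13)] -/
theorem supNorm_le_of_mem_cluster {ε : ℝ} (hε : 0 < ε) {n n' : ℕ} {X : PointConfig E2}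
    (hX : IsHardCore X) {y : E2} (hy : y ∈ cluster ε n X (box n')) :
    ENNReal.ofReal (supNorm y) ≤ (n' : ℝ≥0∞) +
      ∑' m : ℕ, ∑' x : {x : Fin (m + 1) → E2 // Function.Injective x ∧ ∀ i, x i ∈ X},
        ENNReal.ofReal (m * (1 + ε)) * pathFun ((box (n' : ℝ)).indicator 1) ε m x.1 := by
  obtain ⟨x', hx'X, hx'Λ, hconn⟩ := hy
  obtain ⟨m, x, hinj, hmem, hx0, hxm, hbond⟩ := exists_path_of_epsConnected hx'X hconn
  -- the norm bound along the path
  have hy_le : supNorm y ≤ n' + m * (1 + ε) := by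
    have h := abs_supNorm_sub_le_of_path hbond m le_rfl
    rw [show (⟨m, Nat.lt_succ_of_le le_rfl⟩ : Fin (m + 1)) = Fin.last m from rfl, hxm, hx0] at h
    have h0 : supNorm x' ≤ n' := supNorm_le_of_mem_box (Nat.cast_nonneg n') hx'Λ
    linarith [(abs_le.1 h).2]
  -- the weight of the path is `1`
  have hval : pathFun ((box (n' : ℝ)).indicator 1) ε m x = 1 := by
    rw [pathFun_eq_of_path hX _ hinj hmem hbond, hx0, Set.indicator_of_mem hx'Λ, Pi.one_apply]
  -- conclude
  calc ENNReal.ofReal (supNorm y) ≤ ENNReal.ofReal (n' + m * (1 + ε)) := ENNReal.ofReal_le_ofReal hy_le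
    _ = (n' : ℝ≥0∞) + ENNReal.ofReal (m * (1 + ε)) := by
        rw [ENNReal.ofReal_add (Nat.cast_nonneg _) (by positivity), ENNReal.ofReal_natCast]
    _ = (n' : ℝ≥0∞) + ENNReal.ofReal (m * (1 + ε)) * pathFun ((box (n' : ℝ)).indicator 1) ε m x := by
        rw [hval, mul_one]
    _ ≤ (n' : ℝ≥0∞) + ∑' x : {x : Fin (m + 1) → E2 // Function.Injective x ∧ ∀ i, x i ∈ X},
          ENNReal.ofReal (m * (1 + ε)) * pathFun ((box (n' : ℝ)).indicator 1) ε m x.1 := by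
        gcongr
        exact ENNReal.le_tsum (⟨x, hinj, hmem⟩ : {x : Fin (m + 1) → E2 // Function.Injective x ∧ ∀ i, x i ∈ X})
    _ ≤ (n' : ℝ≥0∞) + ∑' m : ℕ, ∑' x : {x : Fin (m + 1) → E2 // Function.Injective x ∧ ∀ i, x i ∈ X},
          ENNReal.ofReal (m * (1 + ε)) * pathFun ((box (n' : ℝ)).indicator 1) ε m x.1 := by
        gcongr
        exact ENNReal.le_tsum m

/-- **The path expansion of the cluster range** (pointwise, for hard-disc configurations):
`r_{n,X}(Λ_{n'}) ≤ n' + ∑_{m} ∑≠_{x₀,…,x_m ∈ X} 1{x₀ ∈ Λ_{n'}} m c_K ∏ 1_{K_ε∖K}(x_{i+1}-x_i)`.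
[cite: Richthammer2007, §6.1 (p. 13)] -/
theorem clusterRange_le_pathSum {ε : ℝ} (hε : 0 < ε) (n n' : ℕ) {X : PointConfig E2}
    (hX : IsHardCore X) :
    clusterRange ε n X (box n') ≤ (n' : ℝ≥0∞) +
      ∑' m : ℕ, ∑' x : {x : Fin (m + 1) → E2 // Function.Injective x ∧ ∀ i, x i ∈ X},
        ENNReal.ofReal (m * (1 + ε)) * pathFun ((box (n' : ℝ)).indicator 1) ε m x.1 :=
  iSup₂_le fun _ hy => supNorm_le_of_mem_cluster hε hX hy

/-! ### Integrating the path weights -/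

/-- The chain weight `∏_{i<m} 1_A(x_i - x_{i-1})` with `x_{-1} = a`. [folklore] -/
def chainFun (A : Set E2) (m : ℕ) (a : E2) (x : Fin m → E2) : ℝ≥0∞ :=
  ∏ i : Fin m, A.indicator 1 (x i - (Fin.cons a x : Fin (m + 1) → E2) i.castSucc)

/-- Peeling off the first point of a chain. [folklore] -/
theorem chainFun_succ_cons (A : Set E2) (m : ℕ) (a b : E2) (y : Fin m → E2) :
    chainFun A (m + 1) a (Fin.cons b y) = A.indicator 1 (b - a) * chainFun A m b y := by
  unfold chainFun
  rw [Fin.prod_univ_succ]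
  congr 1

/-- The chain weight is measurable in the chain. [folklore] -/
theorem measurable_chainFun {A : Set E2} (hA : MeasurableSet A) (m : ℕ) (a : E2) :
    Measurable (chainFun A m a) := by
  unfold chainFun
  refine Finset.measurable_prod _ fun i _ => ?_
  refine (measurable_one.indicator hA).comp ((measurable_pi_apply i).sub ?_)
  rcases Fin.eq_zero_or_eq_succ (i.castSucc) with h | ⟨j, hj⟩
  · simp_rw [h, Fin.cons_zero]
    exact measurable_const
  · simp_rw [hj, Fin.cons_succ]
    exact measurable_pi_apply j

/-- **Translation invariance**: `∫ 1_A(b - a) db = λ²(A)`. [folklore] -/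
theorem lintegral_indicator_sub_const {A : Set E2} (hA : MeasurableSet A) (a : E2) :
    ∫⁻ b, A.indicator (1 : E2 → ℝ≥0∞) (b - a) ∂volume = volume A := by
  have hfun : (fun b : E2 => A.indicator (1 : E2 → ℝ≥0∞) (b - a)) = ((fun b => -a + b) ⁻¹' A).indicator 1 := by
    funext b
    by_cases hb : b - a ∈ A
    · rw [Set.indicator_of_mem hb, Set.indicator_of_mem
        (show b ∈ (fun b : E2 => -a + b) ⁻¹' A by rw [Set.mem_preimage, neg_add_eq_sub]; exact hb)]
      rfl
    · rw [Set.indicator_of_notMem hb, Set.indicator_of_notMem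
        (show b ∉ (fun b : E2 => -a + b) ⁻¹' A by rw [Set.mem_preimage, neg_add_eq_sub]; exact hb)]
  rw [hfun, lintegral_indicator_one (hA.preimage (measurable_const_add (-a))), measure_preimage_add]

/-- **Integrating out a chain by translation invariance**: `∫ ∏_{i<m} 1_A(x_i - x_{i-1}) dx = λ(A)^m`
whatever the anchor `x_{-1} = a` ("we can estimate the integrals over `dx_i` … beginning with
`i = m`; this gives `m` times a factor `c_ε`", Richthammer 2007, §6.1). [cite: Richthammer2007, §6.1 (p. 13)] -/
theorem lintegral_chainFun {A : Set E2} (hA : MeasurableSet A) (m : ℕ) (a : E2) :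
    ∫⁻ x, chainFun A m a x ∂(Measure.pi fun _ : Fin m => (volume : Measure E2)) = volume A ^ m := by
  induction m generalizing a with
  | zero =>
    unfold chainFun
    simp only [Finset.univ_eq_empty, Finset.prod_empty, lintegral_const, Measure.pi_univ, pow_zero, one_mul]
  | succ m ih =>
    have hmeas : Measurable (chainFun A (m + 1) a) := measurable_chainFun hA (m + 1) a
    rw [IsPoissonPointProcess.lintegral_pi_succ_eq_lintegral_lintegral_cons volume m hmeas]
    simp_rw [chainFun_succ_cons]
    have hinner : ∀ b : E2, ∫⁻ y, A.indicator 1 (b - a) * chainFun A m b y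
        ∂(Measure.pi fun _ : Fin m => (volume : Measure E2)) = A.indicator 1 (b - a) * volume A ^ m := by
      intro b
      rw [lintegral_const_mul _ (measurable_chainFun hA m b), ih b]
    simp_rw [hinner]
    have hmi : Measurable (fun b : E2 => A.indicator (1 : E2 → ℝ≥0∞) (b - a)) :=
      (measurable_one.indicator hA).comp (measurable_id.sub_const a)
    rw [lintegral_mul_const _ hmi, pow_succ', lintegral_indicator_sub_const hA a]

/-- **The integral of a path weight**: `∫ w(x₀) ∏ 1_{K_ε∖K}(x_{i+1}-x_i) dx₀⋯dx_m = (∫ w) · c_ε^m`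
("we can estimate the integrals over `dx_i` … beginning with `i = m`. This gives `m` times a factor
`c_ε` and the integration over `dx₀` gives an additional factor `λ²(Λ_{n'})`", §6.1).
[cite: Richthammer2007, §6.1 (p. 13)] -/
theorem lintegral_pathFun {w : E2 → ℝ≥0∞} (hw : Measurable w) (ε : ℝ) (m : ℕ) :
    ∫⁻ x, pathFun w ε m x ∂(Measure.pi fun _ : Fin (m + 1) => (volume : Measure E2)) =
      (∫⁻ b, w b ∂volume) * volume (annulus ε) ^ m := by
  rw [IsPoissonPointProcess.lintegral_pi_succ_eq_lintegral_lintegral_cons volume m (measurable_pathFun hw ε m)]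
  have hcons : ∀ (b : E2) (y : Fin m → E2), pathFun w ε m (Fin.cons b y) = w b * chainFun (annulus ε) m b y := by
    intro b y
    unfold pathFun chainFun
    simp only [Fin.cons_succ]
    rfl
  simp_rw [hcons]
  have hinner : ∀ b : E2, ∫⁻ y, w b * chainFun (annulus ε) m b y
      ∂(Measure.pi fun _ : Fin m => (volume : Measure E2)) = w b * volume (annulus ε) ^ m := by
    intro b
    rw [lintegral_const_mul _ (measurable_chainFun (measurableSet_annulus ε) m b),
      lintegral_chainFun (measurableSet_annulus ε) m b]
  simp_rw [hinner]
  rw [lintegral_mul_const _ hw]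

/-! ### Lemma 7 -/

/-- The series behind Lemma 7: `∑_m m r^m < ∞` for `r < 1` in `ℝ≥0∞`. [folklore] -/
theorem tsum_natCast_mul_pow_lt_top {r : ℝ≥0∞} (hr : r < 1) :
    ∑' m : ℕ, (m : ℝ≥0∞) * r ^ m < ⊤ := by
  have hrtop : r ≠ ⊤ := ne_top_of_lt hr
  set q : ℝ := r.toReal with hq
  have hq0 : 0 ≤ q := ENNReal.toReal_nonneg
  have hq1 : q < 1 := by
    rw [hq, ← ENNReal.toReal_one]
    exact (ENNReal.toReal_lt_toReal hrtop ENNReal.one_ne_top).2 hr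
  have hrq : r = ENNReal.ofReal q := by rw [hq, ENNReal.ofReal_toReal hrtop]
  have hsum : Summable fun m : ℕ => (m : ℝ) ^ 1 * q ^ m :=
    summable_pow_mul_geometric_of_norm_lt_one 1 (by rw [Real.norm_eq_abs, abs_of_nonneg hq0]; exact hq1)
  simp only [pow_one] at hsum
  have heq : (fun m : ℕ => (m : ℝ≥0∞) * r ^ m) = fun m : ℕ => ENNReal.ofReal ((m : ℝ) * q ^ m) := by
    funext m
    rw [ENNReal.ofReal_mul (Nat.cast_nonneg m), ENNReal.ofReal_pow hq0, ENNReal.ofReal_natCast, hrq]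
  rw [heq, ← ENNReal.ofReal_tsum_of_nonneg (fun m => by positivity) hsum]
  exact ENNReal.ofReal_lt_top

/-- **Richthammer 2007, Lemma 7 (cluster bound), for the hard-disc model — proved.** Let `z > 0`,
`μ` a Gibbs measure of the planar hard-disc model at activity `z`, and `ε > 0` with
`z · λ²(K_ε ∖ K) < 1` (the standing choice (5.1) of `ε`, with the Ruelle bound `ξ = 1`), where
`K_ε ∖ K` is the annulus `{1 < |v|₂ < 1 + ε}`. Then for every `n' ∈ ℕ`,
`sup_{n > n'} ∫ μ(dX) r_{n,X}(Λ_{n'}) < ∞`. (The bound `n' + z λ²(Λ_{n'}) c_K ∑_m m (c_ε z)^m`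
of §6.1 does not depend on `n`.) [cite: Richthammer2007, §5.2 Lemma 7 (p. 11), proof §6.1 (p. 13)] -/
theorem Richthammer2007_lemma7 {z : ℝ} (hz : 0 < z) {μ : Measure (PointConfig E2)} (hμ : IsGibbs z μ)
    {ε : ℝ} (hε : 0 < ε)
    (hsmall : ENNReal.ofReal z * volume (Metric.ball (0 : E2) (1 + ε) \ Metric.closedBall 0 1) < 1)
    (n' : ℕ) :
    (⨆ (n : ℕ) (_ : n' < n), ∫⁻ X, clusterRange ε n X (box n') ∂μ) < ⊤ := by
  haveI := hμ.1
  rw [← annulus_eq] at hsmall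
  -- the `n`-independent majorant
  set w : E2 → ℝ≥0∞ := (box (n' : ℝ)).indicator 1 with hw
  have hwm : Measurable w := measurable_one.indicator (measurableSet_box _)
  set S : PointConfig E2 → ℝ≥0∞ := fun X => ∑' m : ℕ,
    ∑' x : {x : Fin (m + 1) → E2 // Function.Injective x ∧ ∀ i, x i ∈ X},
      ENNReal.ofReal (m * (1 + ε)) * pathFun w ε m x.1 with hS
  have hbound : ∀ n : ℕ, ∫⁻ X, clusterRange ε n X (box n') ∂μ ≤ (n' : ℝ≥0∞) + ∫⁻ X, S X ∂μ := by
    intro n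
    calc ∫⁻ X, clusterRange ε n X (box n') ∂μ ≤ ∫⁻ X, (n' : ℝ≥0∞) + S X ∂μ := by
          refine lintegral_mono_ae ?_
          filter_upwards [hμ.ae_isHardCore] with X hX
          exact clusterRange_le_pathSum hε n n' hX
      _ = (n' : ℝ≥0∞) + ∫⁻ X, S X ∂μ := by
          rw [lintegral_add_left measurable_const, lintegral_const, measure_univ, mul_one]
  -- Lemma 3 bounds the expectation of each term of the path expansion
  have hSint : ∫⁻ X, S X ∂μ ≤ ∑' m : ℕ, ENNReal.ofReal z ^ (m + 1) *
      (volume (box (n' : ℝ)) * ENNReal.ofReal (m * (1 + ε)) * volume (annulus ε) ^ m) := by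
    have hFm : ∀ m : ℕ, Measurable fun x : Fin (m + 1) → E2 => ENNReal.ofReal (m * (1 + ε)) * pathFun w ε m x :=
      fun m => (measurable_pathFun hwm ε m).const_mul _
    rw [hS, lintegral_tsum fun m => (measurable_tsum_injective (hFm m)).aemeasurable]
    refine ENNReal.tsum_le_tsum fun m => ?_
    have hvol : ∫⁻ x, ENNReal.ofReal (m * (1 + ε)) * pathFun w ε m x
        ∂(Measure.pi fun _ : Fin (m + 1) => (volume : Measure E2)) =
        volume (box (n' : ℝ)) * ENNReal.ofReal (m * (1 + ε)) * volume (annulus ε) ^ m := by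
      rw [lintegral_const_mul _ (measurable_pathFun hwm ε m), lintegral_pathFun hwm ε m, hw,
        lintegral_indicator_one (measurableSet_box _)]
      ring
    rw [← hvol]
    exact Richthammer2007_lemma3_holds z hz μ hμ (m + 1) _ (hFm m)
  -- the geometric series
  have hfin : ∑' m : ℕ, ENNReal.ofReal z ^ (m + 1) *
      (volume (box (n' : ℝ)) * ENNReal.ofReal (m * (1 + ε)) * volume (annulus ε) ^ m) < ⊤ := by
    have hterm : ∀ m : ℕ, ENNReal.ofReal z ^ (m + 1) *
        (volume (box (n' : ℝ)) * ENNReal.ofReal (m * (1 + ε)) * volume (annulus ε) ^ m) =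
        (ENNReal.ofReal z * volume (box (n' : ℝ)) * ENNReal.ofReal (1 + ε)) *
          ((m : ℝ≥0∞) * (ENNReal.ofReal z * volume (annulus ε)) ^ m) := by
      intro m
      rw [ENNReal.ofReal_mul (Nat.cast_nonneg m), ENNReal.ofReal_natCast]
      ring
    simp_rw [hterm]
    rw [ENNReal.tsum_mul_left]
    refine ENNReal.mul_lt_top ?_ (tsum_natCast_mul_pow_lt_top hsmall)
    refine ENNReal.mul_lt_top (ENNReal.mul_lt_top ENNReal.ofReal_lt_top ?_) ENNReal.ofReal_lt_top
    exact (isBounded_box (n' : ℝ)).measure_lt_top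
  -- conclude
  refine lt_of_le_of_lt (iSup₂_le fun n _ => (hbound n).trans (add_le_add le_rfl hSint)) ?_
  exact ENNReal.add_lt_top.2 ⟨ENNReal.natCast_lt_top n', hfin⟩

end Literature.Barriers.AtomisticToContinuum.HardDisk

end
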